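import Literature.Probability.RandomMatrix.UnitaryInvariantPolar
import Literature.Probability.RandomMatrix.ComplexGaussianNormSq
import Literature.Analysis.InnerProduct.GramSchmidt
import Mathlib.Analysis.InnerProductSpace.GramMatrix
import HarnessLib

/-!
# Haar measure on `U(m)` as the law of the Gram–Schmidt orthonormalisation of a Gaussian matrix

Let `g = (g_0, …, g_{m-1})` be i.i.d. standard complex Gaussian vectors in `ℂ^m` (the columns of
a Ginibre matrix) and let `gsUnitary g` be the unitary matrix whose `j`-th column is the `j`-th
Gram–Schmidt vector `gramSchmidtNormed ℂ g j` (when `g` is linearly independent; `1` otherwise, a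
null event). Then

  `Law(gsUnitary g) = Haar probability measure of U(m)`   (`haarProbability_eq_map_gsUnitary`).

Proof: Gram–Schmidt commutes with unitaries (`gramSchmidtNormed_map_linearIsometry` of
`Literature/Analysis/InnerProduct/GramSchmidt.lean`), the Gaussian law is unitarily invariant, and
linear dependence is a null event
(`pi_gaussianEuc_not_linearIndependent`, by induction on the number of vectors: a proper subspace
is Gaussian-null); hence the law of `gsUnitary g` is a left-invariant probability measure on the
compact group `U(m)`, and the uniqueness of Haar measure (`Measure.haarMeasure_unique`) concludes.
This is the standard "QR of a Ginibre matrix" recipe for sampling Haar unitaries.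

Also proved: measurability of `gsUnitary` (from `measurable_gramSchmidtNormed_apply` of the
`InnerProduct/GramSchmidt` file, whose `gramSchmidt_comp_castSucc` is the prefix property).

## References

* F. Mezzadri, *How to generate random matrices from the classical compact groups*, Notices AMS
  54 (2007) 592–604, §4–5 (Haar measure on `U(N)` via the QR/Gram–Schmidt decomposition of the
  Ginibre ensemble).
* M. L. Eaton, *Group invariance applications in statistics*, IMS 1989, Ch. 7 (uniqueness of
  invariant probability measures; the real orthogonal case, Prop. 7.2).
-/

open MeasureTheory ProbabilityTheory WithLp Matrix InnerProductSpace Submodule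
open scoped ENNReal NNReal

namespace Literature.Probability.RandomMatrix


open Literature.MathematicalPhysics.QuantumFieldTheory (haarProbability)
open Literature.Computability.QuantumComplexity (stdComplexGaussian stdComplexGaussianDensity
  stdComplexGaussian_eq_withDensity continuous_stdComplexGaussianDensity)
open Literature.Analysis.InnerProduct (gramSchmidtNormed_map_linearIsometry
  measurable_gramSchmidtNormed_apply)

/-! ### The Gram–Schmidt unitary -/

section GSUnitary

variable {m : ℕ}

/-- The matrix whose `j`-th column is the `j`-th Gram–Schmidt vector of `g` (entry `(i, j)` is
the `i`-th coordinate of `gramSchmidtNormed ℂ g j`). [folklore] -/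
noncomputable def gsMatrix (g : Fin m → EuclideanSpace ℂ (Fin m)) : Matrix (Fin m) (Fin m) ℂ :=
  fun i j => (gramSchmidtNormed ℂ g j) i

/-- `gsMatrix` is measurable (as a map into `Fin m → Fin m → ℂ`; Mathlib puts no measurable
structure on `Matrix`). [folklore] -/
theorem measurable_gsMatrix : Measurable fun (g : Fin m → EuclideanSpace ℂ (Fin m)) (i j : Fin m) =>
    gsMatrix g i j := by
  refine measurable_pi_lambda _ fun i => measurable_pi_lambda _ fun j => ?_
  change Measurable fun g : Fin m → EuclideanSpace ℂ (Fin m) => (gramSchmidtNormed ℂ g j) i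
  exact (measurable_pi_apply i).comp ((measurable_ofLp_two (Fin m)).comp
    (measurable_gramSchmidtNormed_apply ℂ j))

/-- For linearly independent `g`, `gsMatrix g` is unitary (its columns are orthonormal).
[folklore] -/
theorem gsMatrix_mem_unitaryGroup {g : Fin m → EuclideanSpace ℂ (Fin m)} (h : LinearIndependent ℂ g) :
    gsMatrix g ∈ Matrix.unitaryGroup (Fin m) ℂ := by
  have hon := gramSchmidtNormed_orthonormal h
  rw [Matrix.mem_unitaryGroup_iff']
  ext i j
  have hij := (orthonormal_iff_ite.1 hon) i j
  rw [EuclideanSpace.inner_eq_star_dotProduct] at hij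
  rw [Matrix.mul_apply, Matrix.one_apply, ← hij, dotProduct]
  refine Finset.sum_congr rfl fun k _ => ?_
  simp only [gsMatrix, Matrix.star_apply, Pi.star_apply, mul_comm]

/-- **The Gram–Schmidt unitary** of a family `g` of `m` vectors in `ℂ^m`: the unitary matrix with
columns `gramSchmidtNormed ℂ g j` if `g` is linearly independent, and `1` otherwise (a junk value on
a null set). [cite: Mezzadri2007, §5 (the QR/Gram–Schmidt recipe)] -/
noncomputable def gsUnitary (g : Fin m → EuclideanSpace ℂ (Fin m)) : Matrix.unitaryGroup (Fin m) ℂ :=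
  open Classical in
  if h : LinearIndependent ℂ g then ⟨gsMatrix g, gsMatrix_mem_unitaryGroup h⟩ else 1

open Classical in
/-- The underlying matrix of `gsUnitary g`. [folklore] -/
theorem coe_gsUnitary (g : Fin m → EuclideanSpace ℂ (Fin m)) :
    (gsUnitary g : Matrix (Fin m) (Fin m) ℂ) = if LinearIndependent ℂ g then gsMatrix g else 1 := by
  unfold gsUnitary
  split_ifs <;> rfl

/-- On linearly independent `g`, `gsUnitary g = gsMatrix g`. [folklore] -/
theorem coe_gsUnitary_of_linearIndependent {g : Fin m → EuclideanSpace ℂ (Fin m)}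
    (h : LinearIndependent ℂ g) : (gsUnitary g : Matrix (Fin m) (Fin m) ℂ) = gsMatrix g := by
  rw [coe_gsUnitary, if_pos h]

/-- Linear independence of `m` vectors in `ℂ^m` is a measurable event (the Gram determinant is
continuous). [folklore] -/
theorem measurableSet_linearIndependent :
    MeasurableSet {g : Fin m → EuclideanSpace ℂ (Fin m) | LinearIndependent ℂ g} := by
  have hcont : Continuous fun g : Fin m → EuclideanSpace ℂ (Fin m) => (Matrix.gram ℂ g).det := by
    refine Continuous.matrix_det ?_
    refine continuous_pi fun i => continuous_pi fun j => ?_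
    simp only [Matrix.gram_apply]
    exact (continuous_apply i).inner (continuous_apply j)
  have : {g : Fin m → EuclideanSpace ℂ (Fin m) | LinearIndependent ℂ g} =
      (fun g => (Matrix.gram ℂ g).det) ⁻¹' {0}ᶜ := by
    ext g
    simp only [Set.mem_setOf_eq, Set.mem_preimage, Set.mem_compl_iff, Set.mem_singleton_iff]
    exact (Matrix.det_gram_ne_zero_iff_linearIndependent).symm
  rw [this]
  exact hcont.measurable (MeasurableSet.singleton 0).compl

open Classical in
/-- The coefficient matrix of `gsUnitary` is measurable (as a map into `Fin m → Fin m → ℂ`).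
[folklore] -/
theorem measurable_coe_gsUnitary :
    Measurable fun (g : Fin m → EuclideanSpace ℂ (Fin m)) (i j : Fin m) =>
      (gsUnitary g : Matrix (Fin m) (Fin m) ℂ) i j := by
  have : (fun (g : Fin m → EuclideanSpace ℂ (Fin m)) (i j : Fin m) =>
      (gsUnitary g : Matrix (Fin m) (Fin m) ℂ) i j) = fun g =>
      if LinearIndependent ℂ g then (fun i j => gsMatrix g i j) else fun i j => (1 : Matrix (Fin m) (Fin m) ℂ) i j := by
    funext g
    rw [coe_gsUnitary]
    split_ifs <;> rfl
  rw [this]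
  exact Measurable.ite measurableSet_linearIndependent measurable_gsMatrix measurable_const

/-- `gsUnitary` is measurable (into `U(m)` with its Borel σ-algebra): preimages of open sets,
which are traces of open sets of matrices, are measurable. [folklore] -/
theorem measurable_gsUnitary : Measurable (gsUnitary (m := m)) := by
  refine measurable_of_isOpen fun s hs => ?_
  obtain ⟨U, hU, rfl⟩ := isOpen_induced_iff.1 hs
  have hU' : @IsOpen (Fin m → Fin m → ℂ) _ U := hU
  have hUm : @MeasurableSet (Fin m → Fin m → ℂ) _ U := hU'.measurableSet
  exact measurable_coe_gsUnitary hUm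

/-- **Equivariance**: for a unitary `W` and linearly independent `g`,
`gsMatrix (W g_0, …, W g_{m-1}) = W · gsMatrix g`. [folklore] -/
theorem gsMatrix_comp_unitaryEuclidean (W : Matrix.unitaryGroup (Fin m) ℂ)
    (g : Fin m → EuclideanSpace ℂ (Fin m)) :
    gsMatrix (fun j => unitaryEuclidean W (g j)) = (W : Matrix (Fin m) (Fin m) ℂ) * gsMatrix g := by
  ext i j
  have h := gramSchmidtNormed_map_linearIsometry ℂ (unitaryEuclidean W).toLinearIsometry g j
  simp only [gsMatrix, Matrix.mul_apply]
  change (gramSchmidtNormed ℂ ((unitaryEuclidean W).toLinearIsometry ∘ g) j) i = _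
  rw [h]
  simp only [LinearIsometryEquiv.coe_toLinearIsometry, unitaryEuclidean_apply, Matrix.mulVec,
    dotProduct]

/-- Linear independence is preserved by unitaries. [folklore] -/
theorem linearIndependent_comp_unitaryEuclidean_iff (W : Matrix.unitaryGroup (Fin m) ℂ)
    (g : Fin m → EuclideanSpace ℂ (Fin m)) :
    LinearIndependent ℂ (fun j => unitaryEuclidean W (g j)) ↔ LinearIndependent ℂ g :=
  LinearMap.linearIndependent_iff_of_injOn (unitaryEuclidean W).toLinearEquiv.toLinearMap
    ((unitaryEuclidean W).injective.injOn)

/-- **Equivariance of the Gram–Schmidt unitary** on the linearly independent set. [folklore] -/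
theorem gsUnitary_comp_unitaryEuclidean (W : Matrix.unitaryGroup (Fin m) ℂ)
    {g : Fin m → EuclideanSpace ℂ (Fin m)} (h : LinearIndependent ℂ g) :
    gsUnitary (fun j => unitaryEuclidean W (g j)) = W * gsUnitary g := by
  apply Subtype.ext
  rw [coe_gsUnitary_of_linearIndependent ((linearIndependent_comp_unitaryEuclidean_iff W g).2 h),
    Matrix.UnitaryGroup.mul_val, coe_gsUnitary_of_linearIndependent h, gsMatrix_comp_unitaryEuclidean]

end GSUnitary

/-! ### Linear dependence is a Gaussian-null event -/

section Null

variable {m : ℕ}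

/-- The Gaussian vector law `γ` on `ℂ^m` does not charge proper subspaces. [folklore] -/
theorem gaussianEuc_submodule_eq_zero (S : Submodule ℂ (EuclideanSpace ℂ (Fin m))) (hS : S ≠ ⊤) :
    gaussianEuc (Fin m) S = 0 := by
  -- `γ ≪ Lebesgue` on `ℂ^m`, transported to the Euclidean space
  have hdens : Measurable fun z : ℂ => ENNReal.ofReal (stdComplexGaussianDensity z) :=
    ENNReal.measurable_ofReal.comp continuous_stdComplexGaussianDensity.measurable
  have hpi : gaussianPi (Fin m) = (volume : Measure (Fin m → ℂ)).withDensity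
      (fun x => ∏ j, ENNReal.ofReal (stdComplexGaussianDensity (x j))) := by
    rw [gaussianPi, stdComplexGaussian_eq_withDensity, MeasureTheory.volume_pi]
    exact Literature.MathematicalPhysics.KineticTheory.pi_withDensity_eq (fun _ => volume)
      (fun _ => hdens) (fun _ => Literature.Computability.QuantumComplexity.sigmaFinite_withDensity_stdComplexGaussianDensity)
  have hac : gaussianPi (Fin m) ≪ (volume : Measure (Fin m → ℂ)) := by
    rw [hpi]; exact withDensity_absolutelyContinuous _ _
  set ν : Measure (EuclideanSpace ℂ (Fin m)) := (volume : Measure (Fin m → ℂ)).map (toLp 2) with hν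
  have hac' : gaussianEuc (Fin m) ≪ ν := hac.map (measurable_toLp_two (Fin m))
  haveI : ν.IsAddHaarMeasure := by
    have := (PiLp.continuousLinearEquiv 2 ℝ (fun _ : Fin m => ℂ)).symm.isAddHaarMeasure_map
      (volume : Measure (Fin m → ℂ))
    rw [PiLp.coe_symm_continuousLinearEquiv] at this
    exact this
  have hS' : S.restrictScalars ℝ ≠ ⊤ := by
    rwa [Ne, Submodule.restrictScalars_eq_top_iff]
  have h0 : ν (S.restrictScalars ℝ) = 0 := Measure.addHaar_submodule ν _ hS'
  exact hac' (by simpa using h0)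

/-- **Gaussian vectors are almost surely linearly independent**: for `k ≤ m` i.i.d. standard
complex Gaussian vectors in `ℂ^m`, linear dependence is a null event. [folklore] -/
theorem pi_gaussianEuc_not_linearIndependent (k : ℕ) (hk : k ≤ m) :
    (Measure.pi fun _ : Fin k => gaussianEuc (Fin m))
      {v : Fin k → EuclideanSpace ℂ (Fin m) | ¬ LinearIndependent ℂ v} = 0 := by
  induction k with
  | zero =>
    have : {v : Fin 0 → EuclideanSpace ℂ (Fin m) | ¬ LinearIndependent ℂ v} = ∅ := by
      ext v
      simp only [Set.mem_setOf_eq, Set.mem_empty_iff_false, iff_false, not_not]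
      exact linearIndependent_empty_type
    rw [this, measure_empty]
  | succ k ih =>
    have hk' : k ≤ m := (Nat.le_succ k).trans hk
    have ihk := ih hk'
    set γE := gaussianEuc (Fin m) with hγE
    set μk := Measure.pi fun _ : Fin k => gaussianEuc (Fin m) with hμk
    -- measurability of the dependence events via the Gram determinant
    have hDmeas : ∀ l : ℕ, MeasurableSet {v : Fin l → EuclideanSpace ℂ (Fin m) | ¬ LinearIndependent ℂ v} := by
      intro l
      have hcont : Continuous fun v : Fin l → EuclideanSpace ℂ (Fin m) => (Matrix.gram ℂ v).det := by
        refine Continuous.matrix_det (continuous_pi fun i => continuous_pi fun j => ?_)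
        simp only [Matrix.gram_apply]
        exact (continuous_apply i).inner (continuous_apply j)
      have : {v : Fin l → EuclideanSpace ℂ (Fin m) | ¬ LinearIndependent ℂ v} =
          (fun v => (Matrix.gram ℂ v).det) ⁻¹' {0} := by
        ext v
        simp only [Set.mem_setOf_eq, Set.mem_preimage, Set.mem_singleton_iff]
        rw [← Matrix.det_gram_ne_zero_iff_linearIndependent (𝕜 := ℂ), not_not]
      rw [this]
      exact hcont.measurable (MeasurableSet.singleton 0)
    -- split off the last vector
    set e := MeasurableEquiv.piFinSuccAbove (fun _ : Fin (k + 1) => EuclideanSpace ℂ (Fin m)) (Fin.last k)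
      with he
    have hmp := measurePreserving_piFinSuccAbove (fun _ : Fin (k + 1) => gaussianEuc (Fin m)) (Fin.last k)
    have hμ : (Measure.pi fun _ : Fin (k + 1) => gaussianEuc (Fin m)) = (γE.prod μk).map e.symm := by
      rw [← hmp.symm.map_eq]
    set T : Set (EuclideanSpace ℂ (Fin m) × (Fin k → EuclideanSpace ℂ (Fin m))) :=
      {q | ¬ LinearIndependent ℂ q.2 ∨ q.1 ∈ span ℂ (Set.range q.2)} with hT
    have hpre : e.symm ⁻¹' {v : Fin (k + 1) → EuclideanSpace ℂ (Fin m) | ¬ LinearIndependent ℂ v} = T := by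
      ext q
      rcases q with ⟨x, y⟩
      simp only [Set.mem_preimage, Set.mem_setOf_eq, hT, he, MeasurableEquiv.piFinSuccAbove_symm_apply]
      change ¬ LinearIndependent ℂ (Fin.insertNth (Fin.last k) x y) ↔ _
      rw [Fin.insertNth_last', linearIndependent_finSnoc, not_and_or, not_not]
    have hTmeas : MeasurableSet T := by
      rw [← hpre]; exact e.symm.measurable (hDmeas (k + 1))
    rw [hμ, Measure.map_apply e.symm.measurable (hDmeas (k + 1)), hpre, Measure.prod_apply_symm hTmeas]
    -- fibrewise: the section over `y` is everything if `y` is dependent, a proper subspace otherwise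
    have hsec : ∀ y : Fin k → EuclideanSpace ℂ (Fin m), γE ((fun x => (x, y)) ⁻¹' T) =
        ({y : Fin k → EuclideanSpace ℂ (Fin m) | ¬ LinearIndependent ℂ y}).indicator 1 y := by
      intro y
      by_cases hy : LinearIndependent ℂ y
      · rw [Set.indicator_of_notMem (by simpa using hy)]
        have hset : (fun x => (x, y)) ⁻¹' T = (span ℂ (Set.range y) : Set (EuclideanSpace ℂ (Fin m))) := by
          ext x; simp [hT, hy]
        rw [hset]
        refine gaussianEuc_submodule_eq_zero _ fun htop => ?_
        have hdim := finrank_span_eq_card hy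
        rw [htop, finrank_top, finrank_euclideanSpace, Fintype.card_fin, Fintype.card_fin] at hdim
        omega
      · rw [Set.indicator_of_mem (by simpa using hy)]
        have hset : (fun x => (x, y)) ⁻¹' T = Set.univ := by
          ext x; simp [hT, hy]
        rw [hset, Pi.one_apply, measure_univ]
    simp_rw [hsec]
    rw [lintegral_indicator_one (hDmeas k)]
    exact ihk

end Null

/-! ### Haar measure on `U(m)` = law of the Gram–Schmidt unitary -/

section Haar

variable {m : ℕ}

/-- The column Gaussian law is invariant under a unitary applied to every column. [folklore] -/
theorem pi_gaussianEuc_map_unitaryEuclidean (W : Matrix.unitaryGroup (Fin m) ℂ) :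
    (Measure.pi fun _ : Fin m => gaussianEuc (Fin m)).map (fun g j => unitaryEuclidean W (g j)) =
      Measure.pi fun _ : Fin m => gaussianEuc (Fin m) := by
  rw [Measure.pi_map_pi (fun _ => (unitaryEuclidean W).continuous.measurable.aemeasurable)]
  congr 1
  funext j
  exact gaussianEuc_map_linearIsometryEquiv (unitaryEuclidean W)

/-- **Haar measure on `U(m)` is the law of the Gram–Schmidt orthonormalisation of a matrix of
i.i.d. standard complex Gaussians** (the QR recipe for sampling Haar unitaries).
[cite: Mezzadri2007, §4–5] -/
theorem haarProbability_eq_map_gsUnitary (m : ℕ) :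
    haarProbability (Matrix.unitaryGroup (Fin m) ℂ) =
      (Measure.pi fun _ : Fin m => gaussianEuc (Fin m)).map gsUnitary := by
  set Γ := Measure.pi fun _ : Fin m => gaussianEuc (Fin m) with hΓ
  set μ := Γ.map gsUnitary with hμ
  haveI : IsProbabilityMeasure μ := Measure.isProbabilityMeasure_map measurable_gsUnitary.aemeasurable
  -- left invariance
  haveI : μ.IsMulLeftInvariant := by
    refine ⟨fun W => ?_⟩
    rw [hμ, Measure.map_map (measurable_const_mul W) measurable_gsUnitary]
    have hae : ((fun x => W * x) ∘ gsUnitary) =ᵐ[Γ] gsUnitary ∘ fun g j => unitaryEuclidean W (g j) := by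
      have hnull := pi_gaussianEuc_not_linearIndependent (m := m) m le_rfl
      rw [Filter.EventuallyEq, ae_iff]
      refine measure_mono_null (fun g hg => ?_) hnull
      simp only [Set.mem_setOf_eq, Function.comp_apply] at hg ⊢
      intro hli
      exact hg (gsUnitary_comp_unitaryEuclidean W hli).symm
    have hact : Measurable (fun (g : Fin m → EuclideanSpace ℂ (Fin m)) (j : Fin m) =>
        unitaryEuclidean W (g j)) :=
      measurable_pi_lambda _ fun j => (unitaryEuclidean W).continuous.measurable.comp
        (measurable_pi_apply j)
    rw [Measure.map_congr hae, ← Measure.map_map measurable_gsUnitary hact,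
      pi_gaussianEuc_map_unitaryEuclidean]
  -- uniqueness of the Haar probability measure
  haveI : SecondCountableTopology (Matrix.unitaryGroup (Fin m) ℂ) := by
    haveI : SecondCountableTopology (Matrix (Fin m) (Fin m) ℂ) :=
      inferInstanceAs (SecondCountableTopology (Fin m → Fin m → ℂ))
    exact TopologicalSpace.Subtype.secondCountableTopology _
  have h := Measure.haarMeasure_unique μ (⊤ : TopologicalSpace.PositiveCompacts (Matrix.unitaryGroup (Fin m) ℂ))
  have h1 : μ ((⊤ : TopologicalSpace.PositiveCompacts (Matrix.unitaryGroup (Fin m) ℂ)) : Set _) = 1 := by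
    rw [TopologicalSpace.PositiveCompacts.coe_top]; exact measure_univ
  rw [h1, one_smul] at h
  change Measure.haarMeasure ⊤ = μ
  exact h.symm

end Haar

end Literature.Probability.RandomMatrix
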